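import Summits.BirchSwinnertonDyer.BirchSwinnertonDyer.Theorems.TwoAdicConverseCubicImageStratum
import HarnessLib

/-!
# Route `TwoAdicConverse` (rung S3), items 19218 / 19556: the GAUSSIAN stratum (γ₂) «`ρ̄_{E,2}` onto `S₃` but `ℚ(√Δ) = ℚ(i)`»
# (`−Δ ∈ ℚ×²`) and the other mod-`4`/mod-`8` defect families (`±2Δ ∈ ℚ×²`) — ORDINARITY IS AUTOMATIC at a good `2`, and on (γ₂) the
# local structure is forced: `Δ < 0`, `Δ ∉ ℚ₂×²` (exactly ONE `ℚ₂`-root of `ψ₂²` at a good or multiplicative `2`), exactly one real root, and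
# at an odd multiplicative `ℓ` three `ℚ_ℓ`-roots iff `ℓ ≡ 1 (mod 4)`

Cell `bsd-2adic`, seat `bsd-2adic-conv-1` (GEN 22). THEOREMS ONLY — no named fact, no definition, nothing conditional, no `sorry`.
HONEST FRAMING: bookkeeping on the third off-big-image stratum of item 19218 at a good ordinary `2` (conv-1 GEN 18: the complement of the
surjective-`2`-adic-image habitat at good-ordinary `2` is (β) ∪ (γ₁) ∪ (γ₂), the families `±2Δ ∈ ℚ×²` and `j = −4t³(t+8)` being empty
there) and on the pen's rigid locus `𝔖⁻ ⊇ (γ₂)` of reserve #1 `elliptic-shadow-two` (ADD-2); nothing about `λ`, Selmer groups, `L`-values;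
items stay OPEN; BSD is not proved by any of this. PARTITION (D-0054): none — RANK axis (S3) × X5@2 stratum (γ₂); types-the-object-of.

**Mechanism (all inputs tree theorems).** Good SUPERSINGULAR reduction at `2` gives `Δ_min ≡ 5 (mod 8)`, so none of `−Δ, 2Δ, −2Δ` is a
rational square (`SSTwoAdicImage.not_isSquare_{neg,two_mul,neg_two_mul}_Δ_of_goodSS_two`): with GEN 22's
`TwoAdicConverseGoodOrdAutomaticAtTwo` (rational `2`-torsion, `Δ ∈ ℚ₂×²`) this makes `GoodOrd W 2` AUTOMATIC from good reduction on ALL of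
(β) ∪ (γ₁) ∪ (γ₂) ∪ {`±2Δ ∈ ℚ×²`} — every non-surjective-`2`-adic-image family except `j = −4t³(t + 8)` (which does meet supersingular `2`:
`SSTwoAdicImage.not_twoAdicSurjective_107217l1`). On (γ₂): `Δ = −v²`, so `Δ ∈ K×² ⟺ −1 ∈ K×²`: false in `ℝ` and in `ℚ₂`, and at an odd prime
`ℓ` true iff `ℓ ≡ 1 (mod 4)` (`ZMod.exists_sq_eq_neg_one_iff` + Hensel `PadicSquareClass.isSquare_intCast_padic_of_isSquare_zmod` /
`DeuringLadic.isSquare_zmod_of_isSquare_padic`); the root counts then follow from GEN 21's dyadic dichotomy and GEN 22's field-generic /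
multiplicative-prime dichotomies.

* §1 `goodOrd_two_of_good_of_isSquare_neg_Δ` / `_two_mul_Δ` / `_neg_two_mul_Δ`;
* §2 (γ₂): `Δ_neg_of_isSquare_neg_Δ'`, `not_isSquare_Δ_padic_two_of_isSquare_neg_Δ`, `card_roots_…_padic_two_eq_one_of_good_or_mult_of_isSquare_neg_Δ`,
  `card_roots_…_real_eq_one_of_Δ_neg`, `isSquare_Δ_padic_iff_mod_four_eq_one_of_isSquare_neg_Δ`,
  `card_roots_…_padic_eq_three_iff_mod_four_eq_one_of_mult_odd_of_isSquare_neg_Δ`; and the image reading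
  `not_hasSurjectiveModNGaloisRep_four_of_isSquare_neg_Δ` (Dokchitser–Dokchitser (2), tree theorem).

References: T. Dokchitser, V. Dokchitser, Math. Z. 272 (2012) Thm (1)–(3); J.-P. Serre, *A course in arithmetic* II §3.3; J. H. Silverman,
*AEC* (2009) VII.2, C.14. [DokchitserDokchitserMathZ2012] [Serre1973] [SilvermanAEC2009]
-/

set_option linter.dupNamespace false
set_option autoImplicit false

noncomputable section

open scoped Classical
open Polynomial WeierstrassCurve Literature.NumberTheory.EllipticCurves Literature.NumberTheory.EllipticCurves.Greenberg1999
  Literature.NumberTheory.EllipticCurves.Rank1Residual Summit.BirchSwinnertonDyer.Rank1Residual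

namespace Summit.BirchSwinnertonDyer.BirchSwinnertonDyer.Theorems.TwoAdicTwistConverse

variable (W : WeierstrassCurve ℚ) [W.IsElliptic] [W.IsGloballyMinimal]

/-! ## §1. Ordinarity is automatic on the `−Δ`, `2Δ`, `−2Δ ∈ ℚ×²` families -/

omit [W.IsElliptic] in
/-- **Good at `2` ∧ `−Δ ∈ ℚ×²` (stratum (γ₂), `ℚ(√Δ) = ℚ(i)`) ⇒ good ORDINARY at `2`.** [cite: DokchitserDokchitserMathZ2012, Theorem (2)] -/
theorem goodOrd_two_of_good_of_isSquare_neg_Δ (hgood : W.HasGoodReductionAtPrime 2) (h : IsSquare (-W.Δ)) : GoodOrd W 2 := by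
  rcases goodOrd_or_goodSS_of_good_two W hgood with hgo | hss
  · exact hgo
  · exact absurd h (SSTwoAdicImage.not_isSquare_neg_Δ_of_goodSS_two W hss)

omit [W.IsElliptic] in
/-- **Good at `2` ∧ `2Δ ∈ ℚ×²` ⇒ good ORDINARY at `2`.** [cite: DokchitserDokchitserMathZ2012, Theorem (3)] -/
theorem goodOrd_two_of_good_of_isSquare_two_mul_Δ (hgood : W.HasGoodReductionAtPrime 2) (h : IsSquare (2 * W.Δ)) :
    GoodOrd W 2 := by
  rcases goodOrd_or_goodSS_of_good_two W hgood with hgo | hss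
  · exact hgo
  · exact absurd h (SSTwoAdicImage.not_isSquare_two_mul_Δ_of_goodSS_two W hss)

omit [W.IsElliptic] in
/-- **Good at `2` ∧ `−2Δ ∈ ℚ×²` ⇒ good ORDINARY at `2`.** [cite: DokchitserDokchitserMathZ2012, Theorem (3)] -/
theorem goodOrd_two_of_good_of_isSquare_neg_two_mul_Δ (hgood : W.HasGoodReductionAtPrime 2) (h : IsSquare (-2 * W.Δ)) :
    GoodOrd W 2 := by
  rcases goodOrd_or_goodSS_of_good_two W hgood with hgo | hss
  · exact hgo
  · exact absurd h (SSTwoAdicImage.not_isSquare_neg_two_mul_Δ_of_goodSS_two W hss)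

/-! ## §2. The Gaussian stratum (γ₂): `−Δ ∈ ℚ×²` -/

omit [W.IsGloballyMinimal] in
/-- `−Δ ∈ ℚ×² ⇒ Δ < 0`. [folklore] -/
theorem Δ_neg_of_isSquare_neg_Δ' (h : IsSquare (-W.Δ)) : W.Δ < 0 := by
  obtain ⟨v, hv⟩ := h
  have hΔ0 : W.Δ ≠ 0 := W.isUnit_Δ.ne_zero
  have hv0 : v ≠ 0 := by
    rintro rfl
    exact hΔ0 (by linear_combination -hv)
  nlinarith [mul_self_pos.mpr hv0]

omit [W.IsGloballyMinimal] in
/-- In any field `K ⊇ ℚ`: on (γ₂) `Δ ∈ K×² ⟺ −1 ∈ K×²` (`Δ = −v²`, `v ≠ 0`). [folklore] -/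
theorem isSquare_Δ_iff_isSquare_neg_one_of_isSquare_neg_Δ {K : Type*} [Field K] [CharZero K] (h : IsSquare (-W.Δ)) :
    IsSquare ((W.Δ : ℚ) : K) ↔ IsSquare (-1 : K) := by
  obtain ⟨v, hv⟩ := h
  have hΔ : ((W.Δ : ℚ) : K) = -(((v : ℚ) : K) * v) := by
    rw [show W.Δ = -(v * v) by linear_combination -hv]; push_cast; ring
  have hΔ0 : ((W.Δ : ℚ) : K) ≠ 0 := by exact_mod_cast W.isUnit_Δ.ne_zero
  have hv0 : ((v : ℚ) : K) ≠ 0 := by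
    intro h0; apply hΔ0; rw [hΔ, h0, zero_mul, neg_zero]
  rw [hΔ]
  constructor
  · rintro ⟨s, hs⟩
    refine ⟨s / (v : K), ?_⟩
    field_simp
    linear_combination hs
  · rintro ⟨s, hs⟩
    exact ⟨s * (v : K), by linear_combination ((v : ℚ) : K) * (v : K) * hs⟩

omit [W.IsGloballyMinimal] in
/-- **On (γ₂) `Δ` is NOT a `2`-adic square** (`−1 ∉ ℚ₂×²`: an odd `2`-adic square is `≡ 1 (mod 8)`). So (γ₂) lies in the rigid locus
`Δ ∉ (ℚ₂ˣ)²` (pen ADD-2; card `elliptic-shadow-two` `onRigidLocusAtTwo_of_isSquare_neg_Δ`). [cite: Serre1973, Ch. II §3.3 Thm 4] -/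
theorem not_isSquare_Δ_padic_two_of_isSquare_neg_Δ (h : IsSquare (-W.Δ)) : ¬ IsSquare ((W.Δ : ℚ) : ℚ_[2]) := by
  rw [isSquare_Δ_iff_isSquare_neg_one_of_isSquare_neg_Δ W h]
  intro hsq
  have hsq' : IsSquare (((-1 : ℤ) : ℤ) : ℚ_[2]) := by simpa using hsq
  have := GaloisImage.PadicSquareClass.emod_eight_eq_one_of_isSquare_padicTwo (u := -1) (by decide) hsq'
  omega

/-- **On (γ₂), at a good or multiplicative `2`, `ψ₂²` has EXACTLY ONE root in `ℚ₂`** (`2` does not split completely in `ℚ(E[2])`; dyadic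
type `1` in GEN 21's dichotomy; good ⇒ ordinary is automatic by §1). [cite: SilvermanAEC2009, VII.2] -/
theorem card_roots_twoTorsionPolynomial_padic_two_eq_one_of_good_or_mult_of_isSquare_neg_Δ
    (h2 : W.HasGoodReductionAtPrime 2 ∨ Mult W 2) (h : IsSquare (-W.Δ)) :
    Multiset.card ((W.twoTorsionPolynomial.toPoly).map (algebraMap ℚ ℚ_[2])).roots = 1 := by
  have hW : GoodOrd W 2 ∨ Mult W 2 := by
    rcases h2 with hgood | hm
    · exact Or.inl (goodOrd_two_of_good_of_isSquare_neg_Δ W hgood h)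
    · exact Or.inr hm
  exact card_roots_twoTorsionPolynomial_padic_two_eq_one_of_goodOrd_or_mult W hW
    (not_isSquare_Δ_padic_two_of_isSquare_neg_Δ W h)

omit [W.IsElliptic] [W.IsGloballyMinimal] in
/-- **`Δ < 0` ⇒ `ψ₂²` has EXACTLY ONE real root** (one by the intermediate value theorem; `Δ` is not a real square). [cite: SilvermanAEC2009, III.1] -/
theorem card_roots_twoTorsionPolynomial_real_eq_one_of_Δ_neg (hΔ : W.Δ < 0) :
    Multiset.card ((W.twoTorsionPolynomial.toPoly).map (algebraMap ℚ ℝ)).roots = 1 := by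
  obtain ⟨r, hr⟩ := exists_real_root_twoDivisionCubic' W
  refine card_roots_twoTorsionPolynomial_eq_one_of_root_of_not_isSquare W (by simpa using hr) ?_
  rintro ⟨s, hs⟩
  have h0 : ((W.Δ : ℚ) : ℝ) < 0 := by exact_mod_cast hΔ
  nlinarith [mul_self_nonneg s]

omit [W.IsGloballyMinimal] in
/-- On (γ₂): exactly one real root (`E(ℝ)[2] ≅ ℤ/2`). [cite: SilvermanAEC2009, III.1] -/
theorem card_roots_twoTorsionPolynomial_real_eq_one_of_isSquare_neg_Δ (h : IsSquare (-W.Δ)) :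
    Multiset.card ((W.twoTorsionPolynomial.toPoly).map (algebraMap ℚ ℝ)).roots = 1 :=
  card_roots_twoTorsionPolynomial_real_eq_one_of_Δ_neg W (Δ_neg_of_isSquare_neg_Δ' W h)

omit [W.IsGloballyMinimal] in
/-- **On (γ₂), at an odd prime `ℓ`: `Δ ∈ ℚ_ℓ×² ⟺ ℓ ≡ 1 (mod 4)`** (`−1` is a square in `ℚ_ℓ` iff it is one mod `ℓ`, Hensel; iff `ℓ ≢ 3 (mod 4)`).
[cite: Serre1973, Ch. II §3.3 Thm 3] -/
theorem isSquare_Δ_padic_iff_mod_four_eq_one_of_isSquare_neg_Δ {ℓ : ℕ} [Fact ℓ.Prime] (hℓ : ℓ ≠ 2) (h : IsSquare (-W.Δ)) :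
    IsSquare ((W.Δ : ℚ) : ℚ_[ℓ]) ↔ ℓ % 4 = 1 := by
  rw [isSquare_Δ_iff_isSquare_neg_one_of_isSquare_neg_Δ W h]
  have hℓp : ℓ.Prime := Fact.out
  have hodd : ℓ % 2 = 1 := Nat.odd_iff.mp (hℓp.odd_of_ne_two hℓ)
  have hu : ¬ (ℓ : ℤ) ∣ (-1 : ℤ) := by
    intro hd
    have : (ℓ : ℤ) ∣ 1 := (dvd_neg.mp hd)
    have h1 : ℓ ∣ 1 := by exact_mod_cast this
    exact hℓp.one_lt.ne' (Nat.dvd_one.mp h1)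
  have key : IsSquare (-1 : ℚ_[ℓ]) ↔ IsSquare (-1 : ZMod ℓ) := by
    constructor
    · intro hsq
      have hsq' : IsSquare (((-1 : ℤ) : ℤ) : ℚ_[ℓ]) := by simpa using hsq
      simpa using DeuringLadic.isSquare_zmod_of_isSquare_padic hsq'
    · intro hsq
      have hsq' : IsSquare (((-1 : ℤ) : ℤ) : ZMod ℓ) := by simpa using hsq
      have := GaloisImage.PadicSquareClass.isSquare_intCast_padic_of_isSquare_zmod (p := ℓ) hℓ hu hsq'
      simpa using this
  rw [key, ZMod.exists_sq_eq_neg_one_iff]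
  omega

/-- **On (γ₂), at an odd MULTIPLICATIVE prime `ℓ`: `ψ₂²` has `3` roots in `ℚ_ℓ` iff `ℓ ≡ 1 (mod 4)`** (else exactly `1`): `ℓ` splits completely
in `ℚ(E[2])` iff `ℓ ≡ 1 (mod 4)`. [cite: SilvermanAEC2009, C.14] [cite: Serre1973, Ch. II §3.3 Thm 3] -/
theorem card_roots_twoTorsionPolynomial_padic_eq_three_iff_mod_four_eq_one_of_mult_odd_of_isSquare_neg_Δ {ℓ : ℕ} [Fact ℓ.Prime]
    (hℓ : ℓ ≠ 2) (hm : Mult W ℓ) (h : IsSquare (-W.Δ)) :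
    Multiset.card ((W.twoTorsionPolynomial.toPoly).map (algebraMap ℚ ℚ_[ℓ])).roots = 3 ↔ ℓ % 4 = 1 := by
  rw [card_roots_twoTorsionPolynomial_padic_eq_three_iff_of_mult_odd W hℓ hm,
    isSquare_Δ_padic_iff_mod_four_eq_one_of_isSquare_neg_Δ W hℓ h]

omit [W.IsGloballyMinimal] in
/-- **`−Δ ∈ ℚ×²` ⇒ `ρ̄_{E,4}` is NOT surjective** (Dokchitser–Dokchitser (2), tree theorem
`DokchitserDokchitser2012_surjective_mod_two_four_eight_holds`): (γ₂) is off the surjective-`2`-adic-image habitat.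
[cite: DokchitserDokchitserMathZ2012, Theorem (2)] -/
theorem not_hasSurjectiveModNGaloisRep_four_of_isSquare_neg_Δ (h : IsSquare (-W.Δ)) : ¬ W.HasSurjectiveModNGaloisRep 4 :=
  fun h4 ↦ ((DokchitserDokchitser2012_surjective_mod_two_four_eight_holds W).2.1.mp h4).2.1 h

end Summit.BirchSwinnertonDyer.BirchSwinnertonDyer.Theorems.TwoAdicTwistConverse

end
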